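import Literature.AlgebraicGeometry.HodgeTheory.ChernCharacterLawsRigidity
import HarnessLib

/-!
# The topological laws of a Chern character on complex Betti cohomology, as a predicate on raw data

Family `hodge`, layer `Literature/AlgebraicGeometry/HodgeTheory`. HONEST FRAMING: nothing here constructs a Chern character
or bears on any case of the Hodge conjecture; `ChernCharacterBetti` (`HodgeTheory/ChernCharacterBetti`) stays a hypothesis
structure without an instance. This file is the PREDICATE companion of that structure.

WHY A PREDICATE. `ChernCharacterBetti` bundles the data `ch X E i ∈ H²ⁱ(X(ℂ); ℂ)` with ELEVEN laws: nine topological ones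
(invariance under isomorphism, additivity, functoriality, the two normalisations on free modules, the exponential on rank `≤ 1`,
rationality — Fulton Example 3.2.3, §15.1 (ii)–(iii); Voisin I Thm. 11.23) and two cycle laws on smooth projective varieties
(algebraicity `chᵢ(E) ∈ Nⁱ H²ⁱ`, Fulton Prop. 19.1.2; span `Nᵖ H²ᵖ ⊆ ℂ·{ch_p(E)}`, Fulton Example 15.2.16 (b)). Statements ABOUT
data satisfying only the topological laws — Grothendieck's uniqueness theorem «the axioms determine the classes» (1958, Thm. 1),
or «the topological laws already imply algebraicity» — cannot be phrased over the bundled structure. The tree proves exactly such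
statements with the laws UNBUNDLED (`HodgeTheory/ChernCharacterLawsAlgebraicity.ch_mem_algebraicClasses_of_laws`,
`HodgeTheory/ChernCharacterLawsRigidity.exists_scale_of_laws`, `…span_ch_eq_of_laws`); here they are recorded on the predicate:

* `ChernDatum` — the type of the raw data (`= ` the type of the field `ChernCharacterBetti.ch`);
* `ChernDatum.IsTopological ch` — the nine topological laws, VERBATIM the first nine field types of `ChernCharacterBetti`
  (`ChernCharacterBetti.isTopological : C.ch.IsTopological`);
* `ChernDatum.NonDegenerate ch` — `ch₁(L) ≠ 0` for some module `L` of rank `≤ 1` on some `ℙᴺ` (excludes the rank-only character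
  `ch₀ = rk, ch_{>0} = 0`, which satisfies the nine laws and algebraicity but not span; under rigidity: the scale `q ≠ 0`);
* `ChernDatum.IsTopological.ch_mem_algebraicClasses` — ALGEBRAICITY IS AUTOMATIC (Fulton Prop. 19.1.2 for every lawful datum);
* `ChernDatum.IsTopological.exists_scale(_ne_zero)`, `….span_eq` — GROTHENDIECK UNIQUENESS: two lawful data, the first
  non-degenerate, agree up to `chᵢ ↦ qⁱ chᵢ` on vector bundles over smooth projective varieties (`q ≠ 0` if both are non-degenerate),
  hence have the same spans in positive degrees;
* `ChernDatum.IsTopological.toChernCharacterBetti` — a lawful datum with the span law in POSITIVE degrees IS a `ChernCharacterBetti`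
  (degree `0` from `ch₀(𝒪_X) = 1`, algebraicity from the laws), and the resulting characterisation
  **`nonempty_chernCharacterBetti_iff`**: `Nonempty ChernCharacterBetti ↔ ∃ ch, ch.IsTopological ∧ (span law for ch in degrees ≥ 1)`;
  with uniqueness, `ChernDatum.IsTopological.toChernCharacterBettiOfSpanForOne`: once ONE lawful non-degenerate datum has the span
  law, EVERY lawful non-degenerate datum is a `ChernCharacterBetti`.

The degree-one vocabulary of Grothendieck's axiomatic construction (a first Chern class of line bundles, extended by the projective
bundle theorem and the splitting principle, 1958 Thm. 1 existence) is recorded as `FirstChernDatum`, `FirstChernDatum.IsFirstChernClass`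
(congruence, naturality on rank `≤ 1`, `c₁(𝒪) = 0`, rationality, divisor classes algebraic — Voisin I Thm. 11.23 (ii), Thm. 11.30–11.33),
`FirstChernDatum.NonDegenerate`, and `ChernDatum.firstChern` (`c₁ := ch₁`) with `IsTopological.isFirstChernClass_firstChern`.

## Design and faithfulness

* Field names and types of `IsTopological` are those of `ChernCharacterBetti` (so `⟨ch, h.ch_congr, …⟩`-style transport is literal);
  the quantifiers range over ALL `ℂ`-schemes, as in the structure (the DOMAIN question — Chern classes of the tree live over Hausdorff
  paracompact `X(ℂ)` — is the structure's, not this file's).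
* No junk: `IsTopological` and `NonDegenerate` are `Prop`s on honest data; `toChernCharacterBetti` fills the two cycle fields by
  THEOREMS, never by defaults.
* Not here: any instance; multiplicativity (`ChernCharacterBettiMultiplicative`); twist-normalisation (`ChernCharacterBettiTwistNormalised`,
  a different, STRUCTURE-level normalisation used by LEMMA U for structures).

## References

* [Grothendieck1958] A. Grothendieck, La théorie des classes de Chern, Bull. SMF 86 (1958): Thm. 1, §2–§3.
* [Fulton1998] W. Fulton, Intersection Theory, 2nd ed. (1998): Example 3.2.3, §15.1 (ii)–(iii), Example 15.2.16 (b), Prop. 19.1.2.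
* [VoisinHodgeI2002] C. Voisin, Hodge Theory and Complex Algebraic Geometry I (2002): Thm. 11.23, Thm. 11.30–11.33.
* [Deligne2000] P. Deligne, The Hodge conjecture (Clay, 2000): §2 Remark (ii).
* Tree: `HodgeTheory/ChernCharacterBetti`, `HodgeTheory/ChernCharacterLawsAlgebraicity`, `HodgeTheory/ChernCharacterLawsRigidity`.
-/

noncomputable section

open CategoryTheory AlgebraicGeometry
open Literature.AlgebraicTopology.SingularHomology
open Literature.AlgebraicGeometry.Motives

namespace Literature.AlgebraicGeometry.HodgeTheory

section HodgeTheory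

/-! ### §1 Raw data and the nine topological laws -/

/-- **The raw datum of a Chern character on complex Betti cohomology**: `chᵢ(E) ∈ H²ⁱ(X(ℂ); ℂ)` for every `𝒪_X`-module `E` on every
`ℂ`-scheme `X` — the type of the field `ChernCharacterBetti.ch`. [cite: Fulton1998, Example 3.2.3] -/
abbrev ChernDatum : Type 1 :=
  ∀ (X : SchemeOver ℂ) (E : X.left.Modules) (i : ℕ), complexBetti X (2 * i)

/-- **The nine TOPOLOGICAL laws of a Chern character** (every field of `ChernCharacterBetti` except the two cycle laws
`ch_mem_algebraicClasses`, `algebraicClasses_le_span_ch`), as a predicate on a raw datum — verbatim the field types of the structure: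
isomorphism invariance, additivity on short exact sequences of vector bundles («`ch(E) = ch(E') + ch(E'')`»), functoriality along
`ℂ`-morphisms («`ch ∘ f^* = f^* ∘ ch`»), `ch₀(𝒪^I) = #I`, `chᵢ(𝒪^I) = 0` (`i > 0`), the exponential «`ch[L] = exp(c₁(L))`» on rank `≤ 1`,
rationality. [cite: Fulton1998, Example 3.2.3 and §15.1 (ii)–(iii)] [cite: VoisinHodgeI2002, Thm. 11.23] -/
structure ChernDatum.IsTopological (ch : ChernDatum) : Prop where
  /-- Isomorphic modules have the same Chern character. [cite: Fulton1998, §15.1] -/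
  ch_congr : ∀ {X : SchemeOver ℂ} {E F : X.left.Modules} (_ : E ≅ F) (i : ℕ), ch X E i = ch X F i
  /-- Additivity on short exact sequences of vector bundles. [cite: Fulton1998, Example 3.2.3] -/
  ch_shortExact : ∀ {X : SchemeOver ℂ} (S : ShortComplex X.left.Modules), S.ShortExact →
    IsVectorBundle S.X₁ → IsVectorBundle S.X₃ → ∀ i : ℕ, ch X S.X₂ i = ch X S.X₁ i + ch X S.X₃ i
  /-- Functoriality along every `ℂ`-morphism. [cite: Fulton1998, §15.1 (ii)] -/
  map_ch : ∀ {X Y : SchemeOver ℂ} (f : Y ⟶ X) (E : X.left.Modules), IsVectorBundle E →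
    ∀ i : ℕ, complexBetti.map f (2 * i) (ch X E i) = ch Y ((Scheme.Modules.pullback f.left).obj E) i
  /-- `ch₀(𝒪_X^I) = #I · 1`. [cite: Fulton1998, Example 3.2.3] -/
  ch_free_zero : ∀ (X : SchemeOver ℂ) (I : Type) [Finite I],
    ch X (SheafOfModules.free (R := X.left.ringCatSheaf) I) 0 = (Nat.card I : ℂ) • singularCohomology.one ℂ (ComplexPoints X)
  /-- `chᵢ(𝒪_X^I) = 0` for `0 < i`. [cite: Fulton1998, Example 3.2.3] -/
  ch_free_of_pos : ∀ (X : SchemeOver ℂ) (I : Type) [Finite I] {i : ℕ}, 0 < i →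
    ch X (SheafOfModules.free (R := X.left.ringCatSheaf) I) i = 0
  /-- The exponential on modules of rank `≤ 1`: `chᵢ(L) = ch₁(L)ⁱ/i!` (`0 < i`). [cite: Fulton1998, §15.1 (iii)] -/
  ch_of_hasRankLE_one : ∀ {X : SchemeOver ℂ} {L : X.left.Modules}, HasRankLE L 1 →
    ∀ {i : ℕ}, 0 < i → ch X L i = ((Nat.factorial i : ℕ) : ℂ)⁻¹ • cupPowTwo (ch X L 1) i
  /-- Rationality of `chᵢ(E)` for vector bundles. [cite: VoisinHodgeI2002, Thm. 11.23] -/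
  isRationalClass_ch : ∀ (X : SchemeOver ℂ) (E : X.left.Modules), IsVectorBundle E → ∀ i : ℕ, IsRationalClass (ch X E i)

/-- **Non-degeneracy** of a Chern datum: some module of rank `≤ 1` on some projective space has `ch₁ ≠ 0` (excludes the rank-only
character; under Grothendieck uniqueness it reads «the scale is non-zero»). [cite: Grothendieck1958, Thm. 1] -/
def ChernDatum.NonDegenerate (ch : ChernDatum) : Prop :=
  ∃ (N : ℕ) (L : (projectiveSpace N ℂ).left.Modules), HasRankLE L 1 ∧ ch (projectiveSpace N ℂ) L 1 ≠ 0

/-- The data of a Chern character theory satisfy the nine topological laws (the first nine fields).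
[cite: Fulton1998, Example 3.2.3 and §15.1] -/
theorem ChernCharacterBetti.isTopological (C : ChernCharacterBetti) : ChernDatum.IsTopological C.ch where
  ch_congr e i := C.ch_congr e i
  ch_shortExact S hS h₁ h₃ i := C.ch_shortExact S hS h₁ h₃ i
  map_ch f E hE i := C.map_ch f E hE i
  ch_free_zero X I _ := C.ch_free_zero X I
  ch_free_of_pos X I _ _ hi := C.ch_free_of_pos X I hi
  ch_of_hasRankLE_one hL _ hi := C.ch_of_hasRankLE_one hL hi
  isRationalClass_ch X E hE i := C.isRationalClass_ch X E hE i

/-! ### §2 What the topological laws imply: algebraicity, uniqueness up to scale, equal spans -/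

namespace ChernDatum.IsTopological

variable {ch ch' : ChernDatum}

/-- `ch(0) = 0` for a lawful datum. [cite: Fulton1998, Example 3.2.3] -/
theorem ch_eq_zero_of_isZero (h : ch.IsTopological) {X : SchemeOver ℂ} {E : X.left.Modules} (hE : Limits.IsZero E) (i : ℕ) :
    ch X E i = 0 :=
  ch_eq_zero_of_isZero_of_shortExact ch h.ch_shortExact hE i

/-- **Algebraicity is automatic** (Fulton Prop. 19.1.2 for EVERY lawful datum): `ch X E i ∈ Nⁱ H²ⁱ(X(ℂ); ℂ)` for every vector bundle
on every smooth projective complex variety — `ch_mem_algebraicClasses_of_laws`. [cite: Fulton1998, Prop. 19.1.2 and Cor. 19.2 (b)]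
[cite: VoisinHodgeI2002, Thm. 11.32] -/
theorem ch_mem_algebraicClasses (h : ch.IsTopological) {n : ℕ} {X : SchemeOver ℂ} (hX : IsSmoothProjective n X)
    (E : X.left.Modules) (hE : IsVectorBundle E) (i : ℕ) : ch X E i ∈ algebraicClasses X i :=
  ch_mem_algebraicClasses_of_laws ch h.ch_congr h.ch_shortExact h.map_ch h.ch_of_hasRankLE_one hX E hE i

/-- **Grothendieck uniqueness for lawful data**: if `ch` is lawful and non-degenerate and `ch'` is lawful, there is ONE `q ∈ ℂ` with
`ch' X E i = qⁱ • ch X E i` for all vector bundles on smooth projective varieties and all `i ≥ 1` — `exists_scale_of_laws`.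
[cite: Grothendieck1958, Thm. 1 (uniqueness) and §2] -/
theorem exists_scale (h : ch.IsTopological) (hnd : ch.NonDegenerate) (h' : ch'.IsTopological) :
    ∃ q : ℂ, ∀ {n : ℕ} {X : SchemeOver ℂ}, IsSmoothProjective n X → ∀ (E : X.left.Modules), IsVectorBundle E →
      ∀ {i : ℕ}, 0 < i → ch' X E i = q ^ i • ch X E i :=
  exists_scale_of_laws ch ch' h.ch_congr h.ch_shortExact h.map_ch h.ch_free_of_pos h.ch_of_hasRankLE_one hnd h'.ch_congr
    h'.ch_shortExact h'.map_ch h'.ch_free_of_pos h'.ch_of_hasRankLE_one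

/-- The scale of two NON-DEGENERATE lawful data is non-zero — `exists_scale_ne_zero_of_laws`. [cite: Grothendieck1958, Thm. 1] -/
theorem exists_scale_ne_zero (h : ch.IsTopological) (hnd : ch.NonDegenerate) (h' : ch'.IsTopological)
    (hnd' : ch'.NonDegenerate) :
    ∃ q : ℂ, q ≠ 0 ∧ ∀ {n : ℕ} {X : SchemeOver ℂ}, IsSmoothProjective n X → ∀ (E : X.left.Modules), IsVectorBundle E →
      ∀ {i : ℕ}, 0 < i → ch' X E i = q ^ i • ch X E i :=
  exists_scale_ne_zero_of_laws ch ch' h.ch_congr h.ch_shortExact h.map_ch h.ch_free_of_pos h.ch_of_hasRankLE_one hnd h'.ch_congr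
    h'.ch_shortExact h'.map_ch h'.ch_free_of_pos h'.ch_of_hasRankLE_one hnd'

/-- **Equal spans**: two lawful non-degenerate data have the same `ℂ · {ch_p(E) : E vector bundle}` in every positive degree on every
smooth projective variety — `span_ch_eq_of_laws`. [cite: Grothendieck1958, Thm. 1] [cite: Fulton1998, Example 15.2.16 (b)] -/
theorem span_eq (h : ch.IsTopological) (hnd : ch.NonDegenerate) (h' : ch'.IsTopological) (hnd' : ch'.NonDegenerate)
    {n : ℕ} {X : SchemeOver ℂ} (hX : IsSmoothProjective n X) {p : ℕ} (hp : 0 < p) :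
    Submodule.span ℂ {c | ∃ E : X.left.Modules, IsVectorBundle E ∧ ch' X E p = c} =
      Submodule.span ℂ {c | ∃ E : X.left.Modules, IsVectorBundle E ∧ ch X E p = c} :=
  span_ch_eq_of_laws ch ch' h.ch_congr h.ch_shortExact h.map_ch h.ch_free_of_pos h.ch_of_hasRankLE_one hnd h'.ch_congr
    h'.ch_shortExact h'.map_ch h'.ch_free_of_pos h'.ch_of_hasRankLE_one hnd' hX hp

/-- **Degree `0` of the span law is automatic** on a smooth projective (connected) `X`: `H⁰(X(ℂ); ℂ) = ℂ · 1 = ℂ · ch₀(𝒪_X)`.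
[cite: Fulton1998, Example 3.2.3] -/
theorem span_ch_zero_eq_top (h : ch.IsTopological) {n : ℕ} {X : SchemeOver ℂ} (hX : IsSmoothProjective n X) :
    Submodule.span ℂ {c | ∃ E : X.left.Modules, IsVectorBundle E ∧ ch X E 0 = c} = ⊤ := by
  refine eq_top_iff.2 fun x _ ↦ ?_
  obtain ⟨c, rfl⟩ := exists_eq_smul_one_of_isSmoothProjective hX ℂ x
  have h1 : ch X (SheafOfModules.free (R := X.left.ringCatSheaf) PUnit) 0 = singularCohomology.one ℂ (ComplexPoints X) := by
    rw [h.ch_free_zero X PUnit]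
    simp
  rw [← h1]
  exact Submodule.smul_mem _ _ (Submodule.subset_span ⟨_, isVectorBundle_free PUnit, rfl⟩)

/-- **The span law transfers**: if ONE lawful non-degenerate datum `ch₀` has `Nᵖ H²ᵖ ⊆ ℂ · {ch₀_p(E)}` in positive degrees on smooth
projective varieties, then every lawful non-degenerate datum has the span law in EVERY degree.
[cite: Grothendieck1958, Thm. 1] [cite: Fulton1998, Example 15.2.16 (b)] [cite: Deligne2000, §2 Remark (ii)] -/
theorem algebraicClasses_le_span_of_spanForOne {ch₀ : ChernDatum} (h₀ : ch₀.IsTopological) (hnd₀ : ch₀.NonDegenerate)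
    (hspan₀ : ∀ {n : ℕ} {X : SchemeOver ℂ}, IsSmoothProjective n X → ∀ {p : ℕ}, 0 < p →
      algebraicClasses X p ≤ Submodule.span ℂ {c | ∃ E : X.left.Modules, IsVectorBundle E ∧ ch₀ X E p = c})
    (h : ch.IsTopological) (hnd : ch.NonDegenerate) {n : ℕ} {X : SchemeOver ℂ} (hX : IsSmoothProjective n X) (p : ℕ) :
    algebraicClasses X p ≤ Submodule.span ℂ {c | ∃ E : X.left.Modules, IsVectorBundle E ∧ ch X E p = c} := by
  rcases Nat.eq_zero_or_pos p with rfl | hp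
  · rw [h.span_ch_zero_eq_top hX]
    exact le_top
  · rw [h₀.span_eq hnd₀ h hnd hX hp]
    exact hspan₀ hX hp

/-! ### §3 A lawful datum with the span law IS a `ChernCharacterBetti` -/

/-- **Assembling the structure from the laws**: a datum with the nine topological laws and the span law in positive degrees on smooth
projective varieties is a `ChernCharacterBetti` — algebraicity by `ch_mem_algebraicClasses` (automatic), degree `0` of the span law by
`span_ch_zero_eq_top`. [cite: Fulton1998, §15.1, Prop. 19.1.2 and Example 15.2.16 (b)] -/
def toChernCharacterBetti (h : ch.IsTopological)
    (hspan : ∀ {n : ℕ} {X : SchemeOver ℂ}, IsSmoothProjective n X → ∀ {p : ℕ}, 0 < p →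
      algebraicClasses X p ≤ Submodule.span ℂ {c | ∃ E : X.left.Modules, IsVectorBundle E ∧ ch X E p = c}) :
    ChernCharacterBetti where
  ch := ch
  ch_congr e i := h.ch_congr e i
  ch_shortExact S hS h₁ h₃ i := h.ch_shortExact S hS h₁ h₃ i
  map_ch f E hE i := h.map_ch f E hE i
  ch_free_zero X I _ := h.ch_free_zero X I
  ch_free_of_pos X I _ _ hi := h.ch_free_of_pos X I hi
  ch_of_hasRankLE_one hL _ hi := h.ch_of_hasRankLE_one hL hi
  isRationalClass_ch X E hE i := h.isRationalClass_ch X E hE i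
  ch_mem_algebraicClasses hX E hE i := h.ch_mem_algebraicClasses hX E hE i
  algebraicClasses_le_span_ch hX p := by
    rcases Nat.eq_zero_or_pos p with rfl | hp
    · rw [h.span_ch_zero_eq_top hX]
      exact le_top
    · exact hspan hX hp

/-- The assembled structure has the given data. [cite: Fulton1998, Example 3.2.3] -/
@[simp]
theorem toChernCharacterBetti_ch (h : ch.IsTopological)
    (hspan : ∀ {n : ℕ} {X : SchemeOver ℂ}, IsSmoothProjective n X → ∀ {p : ℕ}, 0 < p →
      algebraicClasses X p ≤ Submodule.span ℂ {c | ∃ E : X.left.Modules, IsVectorBundle E ∧ ch X E p = c}) :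
    (h.toChernCharacterBetti hspan).ch = ch := rfl

/-- **Every lawful non-degenerate datum is a `ChernCharacterBetti` once ONE lawful non-degenerate datum has the span law**
(Grothendieck uniqueness transports the span law). [cite: Grothendieck1958, Thm. 1] [cite: Fulton1998, Example 15.2.16 (b)] -/
def toChernCharacterBettiOfSpanForOne {ch₀ : ChernDatum} (h₀ : ch₀.IsTopological) (hnd₀ : ch₀.NonDegenerate)
    (hspan₀ : ∀ {n : ℕ} {X : SchemeOver ℂ}, IsSmoothProjective n X → ∀ {p : ℕ}, 0 < p →
      algebraicClasses X p ≤ Submodule.span ℂ {c | ∃ E : X.left.Modules, IsVectorBundle E ∧ ch₀ X E p = c})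
    (h : ch.IsTopological) (hnd : ch.NonDegenerate) : ChernCharacterBetti :=
  h.toChernCharacterBetti fun hX _ _ ↦ h₀.algebraicClasses_le_span_of_spanForOne hnd₀ hspan₀ h hnd hX _

/-- The data of `toChernCharacterBettiOfSpanForOne` are the given `ch`. [cite: Fulton1998, Example 3.2.3] -/
@[simp]
theorem toChernCharacterBettiOfSpanForOne_ch {ch₀ : ChernDatum} (h₀ : ch₀.IsTopological) (hnd₀ : ch₀.NonDegenerate)
    (hspan₀ : ∀ {n : ℕ} {X : SchemeOver ℂ}, IsSmoothProjective n X → ∀ {p : ℕ}, 0 < p →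
      algebraicClasses X p ≤ Submodule.span ℂ {c | ∃ E : X.left.Modules, IsVectorBundle E ∧ ch₀ X E p = c})
    (h : ch.IsTopological) (hnd : ch.NonDegenerate) :
    (h₀.toChernCharacterBettiOfSpanForOne hnd₀ hspan₀ h hnd).ch = ch := rfl

end ChernDatum.IsTopological

/-- **`Nonempty ChernCharacterBetti` ⟺ a lawful datum with the span law in positive degrees exists** (the cycle law of
algebraicity and the degree-`0` span law being automatic). This is the exact remaining content of the construction items phrased as
`Nonempty ChernCharacterBetti`. [cite: Fulton1998, §15.1, Prop. 19.1.2 and Example 15.2.16 (b)] [cite: Grothendieck1958, Thm. 1] -/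
theorem nonempty_chernCharacterBetti_iff :
    Nonempty ChernCharacterBetti ↔ ∃ ch : ChernDatum, ch.IsTopological ∧
      ∀ {n : ℕ} {X : SchemeOver ℂ}, IsSmoothProjective n X → ∀ {p : ℕ}, 0 < p →
        algebraicClasses X p ≤ Submodule.span ℂ {c | ∃ E : X.left.Modules, IsVectorBundle E ∧ ch X E p = c} := by
  constructor
  · rintro ⟨C⟩
    exact ⟨C.ch, C.isTopological, fun hX _ _ ↦ C.algebraicClasses_le_span_ch hX _⟩
  · rintro ⟨ch, h, hspan⟩
    exact ⟨h.toChernCharacterBetti hspan⟩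

/-! ### §4 The degree-one vocabulary of Grothendieck's axiomatic construction -/

/-- **The raw datum of a first Chern class of line bundles**: `c₁(L) ∈ H²(X(ℂ); ℂ)` for every `𝒪_X`-module `L` on every `ℂ`-scheme
(meaningful on modules of rank `≤ 1`). [cite: Grothendieck1958, Thm. 1] [cite: VoisinHodgeI2002, Thm. 11.23 (i)] -/
abbrev FirstChernDatum : Type 1 :=
  ∀ (X : SchemeOver ℂ) (L : X.left.Modules), complexBetti X (2 * 1)

/-- **The laws of a first Chern class of line bundles on complex Betti cohomology**: isomorphism invariance, naturality on modules of
rank `≤ 1` along every `ℂ`-morphism, `c₁(𝒪_X) = 0`, rationality, and — on smooth projective varieties — divisor classes are algebraic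
(`c₁(L) ∈ N¹ H²`, the Lefschetz `(1,1)` direction «the classes of divisors are Hodge classes … these subgroups coincide»).
[cite: VoisinHodgeI2002, Thm. 11.23 (ii), Thm. 11.30 and Thm. 11.32] [cite: Grothendieck1958, Thm. 1 (ii)] -/
structure FirstChernDatum.IsFirstChernClass (c₁ : FirstChernDatum) : Prop where
  /-- Isomorphic modules have the same first Chern class. [cite: VoisinHodgeI2002, Thm. 11.23] -/
  congr : ∀ {X : SchemeOver ℂ} {L M : X.left.Modules} (_ : L ≅ M), c₁ X L = c₁ X M
  /-- Naturality along every `ℂ`-morphism on modules of rank `≤ 1`. [cite: VoisinHodgeI2002, Thm. 11.23 (ii)] -/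
  map : ∀ {X Y : SchemeOver ℂ} (f : Y ⟶ X) (L : X.left.Modules), HasRankLE L 1 →
    complexBetti.map f (2 * 1) (c₁ X L) = c₁ Y ((Scheme.Modules.pullback f.left).obj L)
  /-- `c₁(𝒪_X) = 0`. [cite: VoisinHodgeI2002, Thm. 11.23 (i)] -/
  free : ∀ (X : SchemeOver ℂ), c₁ X (SheafOfModules.free (R := X.left.ringCatSheaf) PUnit) = 0
  /-- Rationality on modules of rank `≤ 1`. [cite: VoisinHodgeI2002, Thm. 11.23] -/
  rational : ∀ (X : SchemeOver ℂ) (L : X.left.Modules), HasRankLE L 1 → IsRationalClass (c₁ X L)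
  /-- Divisor classes are algebraic on smooth projective varieties. [cite: VoisinHodgeI2002, Thm. 11.30 and Thm. 11.32] -/
  algebraic : ∀ {n : ℕ} {X : SchemeOver ℂ}, IsSmoothProjective n X → ∀ (L : X.left.Modules),
    HasRankLE L 1 → c₁ X L ∈ algebraicClasses X 1

/-- **Non-degeneracy of a first Chern class**: some module of rank `≤ 1` on some `ℙᴺ` has `c₁ ≠ 0`. [cite: Grothendieck1958, Thm. 1] -/
def FirstChernDatum.NonDegenerate (c₁ : FirstChernDatum) : Prop :=
  ∃ (N : ℕ) (L : (projectiveSpace N ℂ).left.Modules), HasRankLE L 1 ∧ c₁ (projectiveSpace N ℂ) L ≠ 0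

/-- **`c₁ := ch₁`**: the first Chern datum of a Chern datum. [cite: Fulton1998, §15.1 (iii)] -/
abbrev ChernDatum.firstChern (ch : ChernDatum) : FirstChernDatum := fun X L ↦ ch X L 1

/-- **The degree-one part of a lawful Chern datum is a lawful first Chern class** (algebraicity of `ch₁(L)` being automatic,
`ChernDatum.IsTopological.ch_mem_algebraicClasses`). [cite: Fulton1998, §15.1 (iii) and Prop. 19.1.2] [cite: VoisinHodgeI2002, Thm. 11.23] -/
theorem ChernDatum.IsTopological.isFirstChernClass_firstChern {ch : ChernDatum} (h : ch.IsTopological) :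
    ch.firstChern.IsFirstChernClass where
  congr e := h.ch_congr e 1
  map f L hL := h.map_ch f L hL.isVectorBundle 1
  free X := h.ch_free_of_pos X PUnit one_pos
  rational X L hL := h.isRationalClass_ch X L hL.isVectorBundle 1
  algebraic hX L hL := h.ch_mem_algebraicClasses hX L hL.isVectorBundle 1

/-- Non-degeneracy is the same condition on `ch` and on `c₁ = ch₁`. [cite: Grothendieck1958, Thm. 1] -/
theorem ChernDatum.nonDegenerate_firstChern_iff (ch : ChernDatum) : ch.firstChern.NonDegenerate ↔ ch.NonDegenerate :=
  Iff.rfl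

end HodgeTheory

end Literature.AlgebraicGeometry.HodgeTheory

end
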